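import Summits.HubbardSuperconductivity.HubbardSuperconductivity.Theorems.WeakCouplingBCSKlLindhardEnclosureFloorStructural

/-!
# KL-MARGIN-SCAN reader (22) «kernel-lindhard-enclosure» — the per-leaf FLOOR debt is exactly TWO rule predicates

`…FloorStructural` reduced `FloorSoundAt P t` (all trees) to the per-leaf predicate `LeafFloorSoundAt P`.  This file opens the fused leaf
`Params.leaf` by cases on the two shell statuses and shows that `LeafFloorSoundAt P` follows from two RULE-level predicates and nothing else:
`FloorInsideSoundAt P` (the Jensen floor `floorInside` on certified two-shell cells inside `[−piLoZ, piLoZ)²`) and `FloorBdrySoundAt P` (the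
boundary floor `floorBdry` on single-straddle cells inside `[−piLoZ, piLoZ)²`, for ARBITRARY hint payloads — hints are checked inside the
rule, never trusted).  Every other leaf (failed guards, same-side cells, tip cells, cells not inside the floor zone) carries floor term `0`,
sound by non-negativity of the integrand.  Honest framing: bookkeeping over the landed kernel; the two rule predicates are NOT proved here;
floats are floats; nothing in this file asserts a KL margin at any `t′ ≠ 0`, `K₃`, `U₀`, the window or B1g dominance; a Kohn–Luttinger
instability statement is not ODLRO and nothing here proves superconductivity in the Hubbard model.  (p1 g25, 2026-08-29.)
-/

noncomputable section

set_option linter.dupNamespace false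

namespace Summit.HubbardSuperconductivity.HubbardSuperconductivity.Theorems.KlLindhardEnclosure

open Real Set MeasureTheory Literature.MathematicalPhysics.QuantumLattice
open Summit.HubbardSuperconductivity.HubbardSuperconductivity.Theorems

/-- **JENSEN-FLOOR RULE SOUNDNESS at `P`**: on a guarded grid cell whose two shell statuses are certified OPPOSITE (kind `k`: `p` has status
`k`, `p + q` status `!k`) and which lies inside `[−piLoZ, piLoZ)²`, the floor term `floorInside k` (units `2^-30`) is at most `2^30 ·` the
BZ-part of the cell integral of the two-shell integrand. [folklore] -/
def FloorInsideSoundAt (P : Params) : Prop :=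
  ∀ (a b c d : ℤ) (k : Bool),
    (P.cell (P.mkX a) (P.mkX b) (P.mkY c) (P.mkY d)).guards = true →
    P.status (P.cell (P.mkX a) (P.mkX b) (P.mkY c) (P.mkY d)).e1Lo (P.cell (P.mkX a) (P.mkX b) (P.mkY c) (P.mkY d)).e1Hi = some k →
    P.status (P.cell (P.mkX a) (P.mkX b) (P.mkY c) (P.mkY d)).e2Lo (P.cell (P.mkX a) (P.mkX b) (P.mkY c) (P.mkY d)).e2Hi = some (!k) →
    P.inBZ (P.mkX a) (P.mkX b) (P.mkY c) (P.mkY d) = true →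
    IntegrableOn P.integrand brillouinZone volume →
      ((P.floorInside k (P.mkX a) (P.mkX b) (P.mkY c) (P.mkY d) : ℤ) : ℝ) ≤ 2 ^ 30 * P.cellIntBZ a b c d

/-- **BOUNDARY-FLOOR RULE SOUNDNESS at `P`**: on a guarded grid cell inside `[−piLoZ, piLoZ)²` where exactly one of the two points may straddle
(`sh = true`: `p + q` straddles and `p` has certified status `far`; `sh = false`: `p` straddles and `p + q` has status `far`), the boundary
floor term `floorBdry … sh (!far) σx σy` is at most `2^30 ·` the BZ-part of the cell integral, for EVERY hint payload `σx σy`. [folklore] -/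
def FloorBdrySoundAt (P : Params) : Prop :=
  ∀ (a b c d : ℤ) (sh far : Bool) (σx σy : ℕ),
    (P.cell (P.mkX a) (P.mkX b) (P.mkY c) (P.mkY d)).guards = true →
    P.status (P.cell (P.mkX a) (P.mkX b) (P.mkY c) (P.mkY d)).e1Lo (P.cell (P.mkX a) (P.mkX b) (P.mkY c) (P.mkY d)).e1Hi =
      (if sh then some far else none) →
    P.status (P.cell (P.mkX a) (P.mkX b) (P.mkY c) (P.mkY d)).e2Lo (P.cell (P.mkX a) (P.mkX b) (P.mkY c) (P.mkY d)).e2Hi =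
      (if sh then none else some far) →
    P.inBZ (P.mkX a) (P.mkX b) (P.mkY c) (P.mkY d) = true →
    IntegrableOn P.integrand brillouinZone volume →
      ((P.floorBdry (P.cell (P.mkX a) (P.mkX b) (P.mkY c) (P.mkY d)) sh (!far) σx σy (P.mkX a) (P.mkX b) (P.mkY c) (P.mkY d) : ℤ) : ℝ)
        ≤ 2 ^ 30 * P.cellIntBZ a b c d

/-- **THE PER-LEAF FLOOR DEBT IS THE TWO RULES**: `FloorInsideSoundAt P ∧ FloorBdrySoundAt P → LeafFloorSoundAt P`. -/
theorem leafFloorSoundAt_of_rules (P : Params) (hI : FloorInsideSoundAt P) (hB : FloorBdrySoundAt P) : LeafFloorSoundAt P := by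
  intro bd tp a b c d hint
  have h0 : (0 : ℝ) ≤ 2 ^ 30 * P.cellIntBZ a b c d := by
    have := P.cellIntBZ_nonneg a b c d; positivity
  set x0 := P.mkX a with hx0
  set x1 := P.mkX b with hx1
  set y0 := P.mkY c with hy0
  set y1 := P.mkY d with hy1
  by_cases hg : (P.cell x0 x1 y0 y1).guards = true
  · rcases hs1 : P.status (P.cell x0 x1 y0 y1).e1Lo (P.cell x0 x1 y0 y1).e1Hi with _ | ⟨_ | _⟩ <;>
      rcases hs2 : P.status (P.cell x0 x1 y0 y1).e2Lo (P.cell x0 x1 y0 y1).e2Hi with _ | ⟨_ | _⟩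
    · -- none, none : tip cell, floor 0
      simp only [Params.leaf, hg, hs1, hs2, Bool.not_true, Bool.false_eq_true, ↓reduceIte, Int.cast_zero]
      exact h0
    · -- none, some false : p straddles, far point EMPTY is `false`? far = false
      by_cases hbz : P.inBZ x0 x1 y0 y1 = true
      · have := hB a b c d false false
        rcases bd with _ | ⟨σx, σy, τx, τy⟩
        · simp only [Params.leaf, hg, hs1, hs2, hbz, Bool.not_true, Bool.false_eq_true, ↓reduceIte]
          exact this _ _ hg (by simpa using hs1) (by simpa using hs2) hbz hint
        · simp only [Params.leaf, hg, hs1, hs2, hbz, Bool.not_true, Bool.false_eq_true, ↓reduceIte]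
          exact this σx σy hg (by simpa using hs1) (by simpa using hs2) hbz hint
      · rcases bd with _ | ⟨σx, σy, τx, τy⟩ <;>
          simp only [Params.leaf, hg, hs1, hs2, hbz, Bool.not_true, Bool.false_eq_true, ↓reduceIte, Int.cast_zero] <;> exact h0
    · -- none, some true
      by_cases hbz : P.inBZ x0 x1 y0 y1 = true
      · have := hB a b c d false true
        rcases bd with _ | ⟨σx, σy, τx, τy⟩
        · simp only [Params.leaf, hg, hs1, hs2, hbz, Bool.not_true, Bool.false_eq_true, ↓reduceIte]
          exact this _ _ hg (by simpa using hs1) (by simpa using hs2) hbz hint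
        · simp only [Params.leaf, hg, hs1, hs2, hbz, Bool.not_true, Bool.false_eq_true, ↓reduceIte]
          exact this σx σy hg (by simpa using hs1) (by simpa using hs2) hbz hint
      · rcases bd with _ | ⟨σx, σy, τx, τy⟩ <;>
          simp only [Params.leaf, hg, hs1, hs2, hbz, Bool.not_true, Bool.false_eq_true, ↓reduceIte, Int.cast_zero] <;>
          exact h0
    · -- some false, none : p + q straddles, far = false
      by_cases hbz : P.inBZ x0 x1 y0 y1 = true
      · have := hB a b c d true false
        rcases bd with _ | ⟨σx, σy, τx, τy⟩
        · simp only [Params.leaf, hg, hs1, hs2, hbz, Bool.not_true, Bool.not_false, Bool.false_eq_true, ↓reduceIte]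
          exact this _ _ hg (by simpa using hs1) (by simpa using hs2) hbz hint
        · simp only [Params.leaf, hg, hs1, hs2, hbz, Bool.not_true, Bool.not_false, Bool.false_eq_true, ↓reduceIte]
          exact this σx σy hg (by simpa using hs1) (by simpa using hs2) hbz hint
      · rcases bd with _ | ⟨σx, σy, τx, τy⟩ <;>
          simp only [Params.leaf, hg, hs1, hs2, hbz, Bool.not_true, Bool.not_false, Bool.false_eq_true, ↓reduceIte, Int.cast_zero] <;>
          exact h0
    · -- some false, some false : same side, floor 0
      simp only [Params.leaf, hg, hs1, hs2, Bool.not_true, Bool.false_eq_true, ↓reduceIte, Int.cast_zero]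
      exact h0
    · -- some false, some true : two-shell kind II (k = false)
      by_cases hbz : P.inBZ x0 x1 y0 y1 = true
      · simp only [Params.leaf, hg, hs1, hs2, hbz, Bool.not_true, Bool.false_eq_true, ↓reduceIte]
        exact hI a b c d false hg hs1 hs2 hbz hint
      · simp only [Params.leaf, hg, hs1, hs2, hbz, Bool.not_true, Bool.false_eq_true, ↓reduceIte, Int.cast_zero]
        exact h0
    · -- some true, none : p + q straddles, far = true
      by_cases hbz : P.inBZ x0 x1 y0 y1 = true
      · have := hB a b c d true true
        rcases bd with _ | ⟨σx, σy, τx, τy⟩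
        · simp only [Params.leaf, hg, hs1, hs2, hbz, Bool.not_true, Bool.false_eq_true, ↓reduceIte]
          exact this _ _ hg (by simpa using hs1) (by simpa using hs2) hbz hint
        · simp only [Params.leaf, hg, hs1, hs2, hbz, Bool.not_true, Bool.false_eq_true, ↓reduceIte]
          exact this σx σy hg (by simpa using hs1) (by simpa using hs2) hbz hint
      · rcases bd with _ | ⟨σx, σy, τx, τy⟩ <;>
          simp only [Params.leaf, hg, hs1, hs2, hbz, Bool.not_true, Bool.false_eq_true, ↓reduceIte, Int.cast_zero] <;>
          exact h0
    · -- some true, some false : two-shell kind I (k = true)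
      by_cases hbz : P.inBZ x0 x1 y0 y1 = true
      · simp only [Params.leaf, hg, hs1, hs2, hbz, Bool.not_true, Bool.false_eq_true, ↓reduceIte]
        exact hI a b c d true hg hs1 hs2 hbz hint
      · simp only [Params.leaf, hg, hs1, hs2, hbz, Bool.not_true, Bool.false_eq_true, ↓reduceIte, Int.cast_zero]
        exact h0
    · -- some true, some true : same side, floor 0
      simp only [Params.leaf, hg, hs1, hs2, Bool.not_true, Bool.false_eq_true, ↓reduceIte, Int.cast_zero]
      exact h0
  · -- failed guards: (0, none)
    have hg' : (P.cell x0 x1 y0 y1).guards = false := by simpa using hg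
    simp only [Params.leaf, hg', Bool.not_false, ↓reduceIte, Int.cast_zero]
    exact h0

/-- **FLOOR SOUNDNESS FROM THE TWO RULES, for every certificate tree.** -/
theorem floorSoundAt_of_rules (P : Params) (hI : FloorInsideSoundAt P) (hB : FloorBdrySoundAt P) (t : QB) : FloorSoundAt P t :=
  floorSoundAt_of_leafFloorSound P (leafFloorSoundAt_of_rules P hI hB) t

end Summit.HubbardSuperconductivity.HubbardSuperconductivity.Theorems.KlLindhardEnclosure

end
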